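import Summits.PneNP.PneNP.Theorems.OneSliceConstantBandTransferStepAux

/-!
# Route OneSlice, item `ShallowSliceBound` (stmt-PneNP-14083): planting a clique on a slice

Helper file (prover seat, 2026-08-16), def-free (vocabulary: `Edge`, `slice`, `errSet` of
`Theorems/ConstantBand/Negative/LoadBearing.lean`; `cliqueVec`, `cliqueCount`, `edgeCount` of the Literature).
**Leg A, step 1** of the proof of `ShallowSliceBound`: a function `f` that is accurate for `k`-CLIQUE on the
slice `j = j' + C(k,2)` accepts `H ⊔ K_A` for most pairs (`H` on slice `j'`, `A` a `k`-set). Counting pairs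
`(H, A)` with `f(H ⊔ K_A) = 0`:

* `card_overlap_pairs_mul_le` — pairs with `E(H) ∩ E(K_A) ≠ ∅` are few: `# · C(n,2) ≤ C(n,k) C(k,2) j' #slice_{j'}`;
* `card_disjoint_bad_pairs_sq_le` — for DISJOINT rejected pairs, `(H,A) ↦ (H ⊔ K_A, A)` is injective into
  `{(x, A) : |x| = j, f x = 0, K_A ⊆ x}`, whose size is `Σ_{x rejected} ω_k(x)`; Cauchy–Schwarz gives
  `#² ≤ #{x ∈ slice_j : f x = 0, ω_k(x) ≠ 0} · Σ_{x ∈ slice_j} ω_k(x)²`;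
* `sum_cliqueCount_sq_le` + `sum_sum_pow_inter_le` — the slice second moment
  `Σ_{slice_j} ω_k² ≤ #slice_j Σ_{A,B} (j/N)^{2K - C(|A∩B|,2)} ≤ #slice_j C(n,k) p^K (1 + k 2^k b^K)` (hypergeometric
  tail `ts_card_slice_filter_supset_mul_le`, overlap sum `sum_erase_pow_inter_le` of `CliqueThresholdBounds.lean`);
* `card_badH_mul_le` — Markov: the `H` for which fewer than half of the `A` are accepted number at most
  `2 #bad / C(n,k)`.
-/

set_option linter.dupNamespace false

noncomputable section

namespace Summit.PneNP.PneNP.Theorems.ShallowSliceBound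

open Finset Literature.Computability.Complexity Classical
open Summit.PneNP.PneNP.Theorems.ConstantBand.Negative (Edge slice errSet)
open Summit.PneNP.PneNP.Cruxes.ConstantBand.FlatPriorRelativeMinterms
  (ts_mem_slice ts_card_slice_pos ts_card_slice_filter_supset_mul_le)

variable {n : ℕ}

/-! ### Overlapping pairs -/

/-- **Overlapping pairs are few**: the pairs `(H, A)` (`H` on slice `j'`, `A` a `k`-set) sharing an edge satisfy
`# · C(n,2) ≤ C(n,k) · C(k,2) · j' · #slice_{j'}` (each of the `C(k,2)` edges of `K_A` lies in a fraction `j'/C(n,2)`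
of the `H`). [folklore] -/
theorem card_overlap_pairs_mul_le (k j' : ℕ) (hj' : j' ≤ n.choose 2) :
    #((slice n j' ×ˢ powersetCard k (univ : Finset (Fin n))).filter
        fun p => ∃ e, p.1 e = true ∧ cliqueVec p.2 e = true) * n.choose 2 ≤
      n.choose k * k.choose 2 * j' * #(slice n j') := by
  set 𝒜 := powersetCard k (univ : Finset (Fin n)) with h𝒜
  -- cover by the sets `{H : H e = 1} × {A}` over `A` and `e ∈ E(K_A)`
  have hcover : ((slice n j' ×ˢ 𝒜).filter fun p => ∃ e, p.1 e = true ∧ cliqueVec p.2 e = true) ⊆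
      𝒜.biUnion fun A => (univ.filter fun e : Edge n => cliqueVec A e = true).biUnion fun e =>
        ((slice n j').filter fun H => H e = true).map ⟨fun H => (H, A), fun H H' h => (Prod.ext_iff.1 h).1⟩ := by
    intro p hp
    rw [mem_filter, mem_product] at hp
    obtain ⟨⟨hH, hA⟩, e, hHe, hAe⟩ := hp
    rw [mem_biUnion]
    refine ⟨p.2, hA, mem_biUnion.2 ⟨e, mem_filter.2 ⟨mem_univ _, hAe⟩, ?_⟩⟩
    rw [mem_map]
    exact ⟨p.1, mem_filter.2 ⟨hH, hHe⟩, rfl⟩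
  have h1 : #((slice n j' ×ˢ 𝒜).filter fun p => ∃ e, p.1 e = true ∧ cliqueVec p.2 e = true) ≤
      ∑ A ∈ 𝒜, ∑ e ∈ univ.filter (fun e : Edge n => cliqueVec A e = true), #((slice n j').filter fun H => H e = true) := by
    refine (card_le_card hcover).trans (card_biUnion_le.trans (sum_le_sum fun A _ => card_biUnion_le.trans ?_))
    exact sum_le_sum fun e _ => by rw [card_map]
  -- each summand: `#{H : H e} · N ≤ j' · #slice`
  have h2 : ∀ e : Edge n, #((slice n j').filter fun H => H e = true) * n.choose 2 ≤ j' * #(slice n j') := by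
    intro e
    have := ts_card_slice_filter_supset_mul_le ({e} : Finset (Edge n)) hj'
    simpa using this
  calc #((slice n j' ×ˢ 𝒜).filter fun p => ∃ e, p.1 e = true ∧ cliqueVec p.2 e = true) * n.choose 2
      ≤ (∑ A ∈ 𝒜, ∑ e ∈ univ.filter (fun e : Edge n => cliqueVec A e = true),
          #((slice n j').filter fun H => H e = true)) * n.choose 2 := Nat.mul_le_mul_right _ h1
    _ = ∑ A ∈ 𝒜, ∑ e ∈ univ.filter (fun e : Edge n => cliqueVec A e = true),
          #((slice n j').filter fun H => H e = true) * n.choose 2 := by rw [sum_mul]; simp_rw [sum_mul]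
    _ ≤ ∑ A ∈ 𝒜, ∑ _e ∈ univ.filter (fun e : Edge n => cliqueVec A e = true), j' * #(slice n j') :=
        sum_le_sum fun A _ => sum_le_sum fun e _ => h2 e
    _ = n.choose k * k.choose 2 * j' * #(slice n j') := by
        have : ∀ A ∈ 𝒜, ∑ _e ∈ univ.filter (fun e : Edge n => cliqueVec A e = true), j' * #(slice n j') =
            k.choose 2 * (j' * #(slice n j')) := by
          intro A hA
          rw [sum_const, smul_eq_mul, card_filter_cliqueVec, (mem_powersetCard.1 hA).2]
        rw [sum_congr rfl this, sum_const, smul_eq_mul, h𝒜, card_powersetCard, card_univ, Fintype.card_fin]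
        ring

/-! ### Disjoint rejected pairs: injection, Cauchy–Schwarz -/

/-- The edge count of a disjoint union `H ⊔ K_A` is `|H| + C(|A|, 2)`. [folklore] -/
theorem edgeCount_sup_cliqueVec_of_disjoint (H : Edge n → Bool) (A : Finset (Fin n))
    (hdisj : ∀ e, ¬ (H e = true ∧ cliqueVec A e = true)) :
    edgeCount (H ⊔ cliqueVec A) = edgeCount H + (#A).choose 2 := by
  rw [← card_filter_cliqueVec A, edgeCount, edgeCount, ← card_union_of_disjoint]
  · congr 1
    ext e
    simp only [mem_filter, mem_univ, true_and, mem_union, sup_apply_bool, Bool.or_eq_true]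
  · rw [disjoint_left]
    intro e h1 h2
    rw [mem_filter] at h1 h2
    exact hdisj e ⟨h1.2, h2.2⟩

/-- **Disjoint rejected pairs inject into rejected graphs with a marked clique**: for `H` on slice `j'`, `A` a
`k`-set with `E(H) ∩ E(K_A) = ∅` and `f(H ⊔ K_A) = 0`, the pair `(H ⊔ K_A, A)` has `H ⊔ K_A` on slice
`j' + C(k,2)`, rejected, containing `K_A`, and determines `(H, A)`; hence
`#{disjoint rejected pairs} ≤ Σ_{x ∈ slice_j, f x = 0} ω_k(x)`. [folklore] -/
theorem card_disjoint_bad_pairs_le (f : (Edge n → Bool) → Bool) (k j' : ℕ) :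
    #((slice n j' ×ˢ powersetCard k (univ : Finset (Fin n))).filter fun p =>
        (∀ e, ¬ (p.1 e = true ∧ cliqueVec p.2 e = true)) ∧ f (p.1 ⊔ cliqueVec p.2) = false) ≤
      ∑ x ∈ (slice n (j' + k.choose 2)).filter (fun x => f x = false), cliqueCount n k x := by
  set 𝒜 := powersetCard k (univ : Finset (Fin n)) with h𝒜
  set j := j' + k.choose 2 with hj
  -- the target set of pairs `(x, A)`
  set E := ((slice n j).filter (fun x => f x = false) ×ˢ 𝒜).filter
    fun q => ∀ e, cliqueVec q.2 e = true → q.1 e = true with hE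
  have hEcard : #E = ∑ x ∈ (slice n j).filter (fun x => f x = false), cliqueCount n k x := by
    rw [hE, card_filter, sum_product]
    refine sum_congr rfl fun x _ => ?_
    rw [cliqueCount, ← card_filter]
  rw [← hEcard]
  refine card_le_card_of_injOn (fun p => (p.1 ⊔ cliqueVec p.2, p.2)) ?_ ?_
  · intro p hp
    rw [mem_coe, mem_filter, mem_product] at hp
    obtain ⟨⟨hH, hA⟩, hdisj, hf⟩ := hp
    rw [mem_coe, hE, mem_filter, mem_product, mem_filter]
    refine ⟨⟨⟨?_, hf⟩, hA⟩, fun e he => ?_⟩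
    · rw [ts_mem_slice] at hH ⊢
      rw [edgeCount_sup_cliqueVec_of_disjoint _ _ hdisj, hH, (mem_powersetCard.1 hA).2]
    · show (p.1 ⊔ cliqueVec p.2) e = true
      rw [sup_apply_bool, he, Bool.or_true]
  · rintro ⟨H, A⟩ hp ⟨H', A'⟩ hp' heq
    simp only [Prod.mk.injEq] at heq
    obtain ⟨hx, rfl⟩ := heq
    rw [mem_coe, mem_filter] at hp hp'
    refine Prod.ext ?_ rfl
    funext e
    have h1 := congrFun hx e
    rw [sup_apply_bool, sup_apply_bool] at h1
    have hd := hp.2.1 e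
    have hd' := hp'.2.1 e
    revert h1 hd hd'
    simp only
    cases H e <;> cases H' e <;> cases cliqueVec A e <;> simp

/-- **Cauchy–Schwarz**: `(Σ_{x ∈ slice_j, f x = 0} ω_k(x))² ≤ #{x ∈ slice_j : f x = 0, ω_k(x) ≠ 0} · Σ_{x ∈ slice_j} ω_k(x)²`.
[folklore] -/
theorem sum_cliqueCount_sq_le_card_mul (f : (Edge n → Bool) → Bool) (k j : ℕ) :
    ((∑ x ∈ (slice n j).filter (fun x => f x = false), cliqueCount n k x : ℕ) : ℝ) ^ 2 ≤
      #((slice n j).filter fun x => f x = false ∧ cliqueCount n k x ≠ 0) *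
        ∑ x ∈ slice n j, (cliqueCount n k x : ℝ) ^ 2 := by
  set E := (slice n j).filter (fun x => f x = false ∧ cliqueCount n k x ≠ 0) with hE
  have hsum : ((∑ x ∈ (slice n j).filter (fun x => f x = false), cliqueCount n k x : ℕ) : ℝ) =
      ∑ x ∈ E, (1 : ℝ) * (cliqueCount n k x : ℝ) := by
    push_cast
    rw [hE]
    have : (slice n j).filter (fun x => f x = false ∧ cliqueCount n k x ≠ 0) =
        ((slice n j).filter (fun x => f x = false)).filter (fun x => cliqueCount n k x ≠ 0) := by
      rw [filter_filter]
    rw [this]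
    simp only [one_mul]
    symm
    exact sum_filter_of_ne fun x _ hx => by exact_mod_cast hx
  rw [hsum]
  refine (sum_mul_sq_le_sq_mul_sq E (fun _ => (1 : ℝ)) (fun x => (cliqueCount n k x : ℝ))).trans ?_
  simp only [one_pow, sum_const, nsmul_eq_mul, mul_one]
  refine mul_le_mul_of_nonneg_left ?_ (Nat.cast_nonneg _)
  exact sum_le_sum_of_subset_of_nonneg (filter_subset _ _) fun _ _ _ => sq_nonneg _

/-! ### The second moment of `ω_k` on a slice -/

/-- `K_A ∪ K_B` has `2 C(k,2) - C(|A ∩ B|, 2)` edges for `k`-sets `A, B`. [folklore] -/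
theorem card_filter_cliqueVec_or {k : ℕ} {A B : Finset (Fin n)}
    (hA : A ∈ powersetCard k (univ : Finset (Fin n))) (hB : B ∈ powersetCard k (univ : Finset (Fin n))) :
    #(univ.filter fun e : Edge n => cliqueVec A e = true ∨ cliqueVec B e = true) =
      2 * k.choose 2 - (#(A ∩ B)).choose 2 := by
  have hAk := (mem_powersetCard.1 hA).2
  have hBk := (mem_powersetCard.1 hB).2
  have hsplit : (univ.filter fun e : Edge n => cliqueVec A e = true ∨ cliqueVec B e = true) =
      (univ.filter fun e : Edge n => cliqueVec A e = true) ∪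
        (univ.filter fun e : Edge n => cliqueVec B e = true ∧ cliqueVec A e = false) := by
    ext e
    simp only [mem_filter, mem_univ, true_and, mem_union]
    cases cliqueVec A e <;> simp
  rw [hsplit, card_union_of_disjoint, card_filter_cliqueVec, card_filter_cliqueVec_and_not, hAk, hBk]
  · have : (#(A ∩ B)).choose 2 ≤ k.choose 2 := by
      rw [← hAk]; exact Nat.choose_le_choose 2 (card_le_card inter_subset_left)
    omega
  · rw [disjoint_left]
    intro e h1 h2
    rw [mem_filter] at h1 h2
    rw [h1.2] at h2
    exact Bool.noConfusion h2.2.2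

/-- **Second moment on a slice**: `Σ_{x ∈ slice_j} ω_k(x)² ≤ #slice_j · Σ_{A,B} (j/C(n,2))^{2C(k,2) - C(|A∩B|,2)}`
(expand the square and apply the hypergeometric tail to the edges of `K_A ∪ K_B`). [folklore] -/
theorem sum_cliqueCount_sq_le {k j : ℕ} (hj : j ≤ n.choose 2) :
    ∑ x ∈ slice n j, (cliqueCount n k x : ℝ) ^ 2 ≤
      #(slice n j) * ∑ A ∈ powersetCard k (univ : Finset (Fin n)), ∑ B ∈ powersetCard k (univ : Finset (Fin n)),
        ((j : ℝ) / n.choose 2) ^ (2 * k.choose 2 - (#(A ∩ B)).choose 2) := by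
  set 𝒜 := powersetCard k (univ : Finset (Fin n)) with h𝒜
  -- expand the square
  have hsq : ∀ x : Edge n → Bool, (cliqueCount n k x : ℝ) ^ 2 =
      ∑ A ∈ 𝒜, ∑ B ∈ 𝒜, if (∀ e, cliqueVec A e = true → x e = true) ∧ (∀ e, cliqueVec B e = true → x e = true)
        then (1 : ℝ) else 0 := by
    intro x
    have hc : (cliqueCount n k x : ℝ) = ∑ A ∈ 𝒜, if (∀ e, cliqueVec A e = true → x e = true) then (1 : ℝ) else 0 := by
      rw [cliqueCount, card_eq_sum_ones, Nat.cast_sum, sum_filter]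
      refine sum_congr rfl fun A _ => ?_
      split_ifs <;> simp
    rw [hc, sq, sum_mul_sum]
    refine sum_congr rfl fun A _ => sum_congr rfl fun B _ => ?_
    by_cases hA : ∀ e, cliqueVec A e = true → x e = true <;>
      by_cases hB : ∀ e, cliqueVec B e = true → x e = true
    · rw [if_pos hA, if_pos hB, if_pos ⟨hA, hB⟩, mul_one]
    · have hAB : ¬ ((∀ e, cliqueVec A e = true → x e = true) ∧ (∀ e, cliqueVec B e = true → x e = true)) :=
        fun h => hB h.2
      rw [if_pos hA, if_neg hB, if_neg hAB, mul_zero]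
    · have hAB : ¬ ((∀ e, cliqueVec A e = true → x e = true) ∧ (∀ e, cliqueVec B e = true → x e = true)) :=
        fun h => hA h.1
      rw [if_neg hA, if_neg hAB, zero_mul]
    · have hAB : ¬ ((∀ e, cliqueVec A e = true → x e = true) ∧ (∀ e, cliqueVec B e = true → x e = true)) :=
        fun h => hA h.1
      rw [if_neg hA, if_neg hAB, zero_mul]
  simp only [hsq]
  rw [sum_comm]
  rw [mul_sum]
  refine sum_le_sum fun A hA => ?_
  rw [sum_comm, mul_sum]
  refine sum_le_sum fun B hB => ?_
  rw [sum_boole]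
  -- the hypergeometric tail for `F = E(K_A ∪ K_B)`
  set F := univ.filter fun e : Edge n => cliqueVec A e = true ∨ cliqueVec B e = true with hF
  have htail := ts_card_slice_filter_supset_mul_le F hj (n := n)
  have hset : (slice n j).filter (fun x => (∀ e, cliqueVec A e = true → x e = true) ∧
      (∀ e, cliqueVec B e = true → x e = true)) = (slice n j).filter fun x => ∀ e ∈ F, x e = true := by
    refine filter_congr fun x _ => ?_
    simp only [hF, mem_filter, mem_univ, true_and]
    constructor
    · rintro ⟨h1, h2⟩ e (he | he)
      · exact h1 e he
      · exact h2 e he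
    · intro h
      exact ⟨fun e he => h e (Or.inl he), fun e he => h e (Or.inr he)⟩
  rw [hset, ← card_filter_cliqueVec_or hA hB, ← hF]
  have hN : (0 : ℝ) ≤ (n.choose 2 : ℝ) := Nat.cast_nonneg _
  rcases (Nat.eq_zero_or_pos (n.choose 2)) with hN0 | hNpos
  · -- degenerate: no edges, `j = 0`
    have hj0 : j = 0 := by omega
    subst hj0
    rw [hN0, Nat.cast_zero]
    rcases Nat.eq_zero_or_pos #F with hF0 | hFpos
    · rw [hF0, pow_zero, mul_one]
      exact_mod_cast card_filter_le _ _
    · -- `F` non-empty but there are no edges at all: impossible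
      exfalso
      obtain ⟨e, _⟩ := card_pos.1 hFpos
      have : Fintype.card (Edge n) = 0 := by rw [card_edgeSet_top_fin]; exact hN0
      exact (Fintype.card_eq_zero_iff.1 this).elim e
  have hNr : (0 : ℝ) < (n.choose 2 : ℝ) := by exact_mod_cast hNpos
  rw [div_pow, mul_div_assoc', le_div_iff₀ (pow_pos hNr _), mul_comm (#(slice n j) : ℝ)]
  exact_mod_cast htail

/-- **The overlap double sum at the threshold**: for `0 ≤ p ≤ b n^{-2/(k-1)}`, `b ≥ 1`, `n ≥ 1`, `k ≥ 2`,
`Σ_{A,B} p^{2C(k,2) - C(|A∩B|,2)} ≤ C(n,k) p^{C(k,2)} (1 + k 2^k b^{C(k,2)})` (diagonal + `sum_erase_pow_inter_le`).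
[cite: Rossman2010, App. B (proof of Lemma 23 (a), p. 14)] -/
theorem sum_sum_pow_inter_le {k : ℕ} (hk : 2 ≤ k) (hn : 1 ≤ n) {p b : ℝ} (hp0 : 0 ≤ p) (hb : 1 ≤ b)
    (hpb : p ≤ b * (n : ℝ) ^ (-(2 : ℝ) / ((k : ℝ) - 1))) :
    ∑ A ∈ powersetCard k (univ : Finset (Fin n)), ∑ B ∈ powersetCard k (univ : Finset (Fin n)),
        p ^ (2 * k.choose 2 - (#(A ∩ B)).choose 2) ≤
      (n.choose k : ℝ) * p ^ k.choose 2 * (1 + k * 2 ^ k * b ^ k.choose 2) := by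
  set 𝒜 := powersetCard k (univ : Finset (Fin n)) with h𝒜
  have hterm : ∀ A ∈ 𝒜, ∑ B ∈ 𝒜, p ^ (2 * k.choose 2 - (#(A ∩ B)).choose 2) ≤
      p ^ k.choose 2 * (1 + k * 2 ^ k * b ^ k.choose 2) := by
    intro A hA
    have hAk := (mem_powersetCard.1 hA).2
    rw [← add_sum_erase 𝒜 _ hA, inter_self, hAk]
    have hdiag : p ^ (2 * k.choose 2 - k.choose 2) = p ^ k.choose 2 := by congr 1; omega
    rw [hdiag]
    have hoff : ∑ B ∈ 𝒜.erase A, p ^ (2 * k.choose 2 - (#(A ∩ B)).choose 2) =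
        p ^ k.choose 2 * ∑ B ∈ 𝒜.erase A, p ^ (k.choose 2 - (#(A ∩ B)).choose 2) := by
      rw [mul_sum]
      refine sum_congr rfl fun B hB => ?_
      rw [← pow_add]; congr 1
      have : (#(A ∩ B)).choose 2 ≤ k.choose 2 := by
        rw [← hAk]; exact Nat.choose_le_choose 2 (card_le_card inter_subset_left)
      omega
    rw [hoff]
    have := sum_erase_pow_inter_le hk hn hp0 hb hpb hA
    have hpK : 0 ≤ p ^ k.choose 2 := pow_nonneg hp0 _
    nlinarith
  calc ∑ A ∈ 𝒜, ∑ B ∈ 𝒜, p ^ (2 * k.choose 2 - (#(A ∩ B)).choose 2)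
      ≤ ∑ _A ∈ 𝒜, p ^ k.choose 2 * (1 + k * 2 ^ k * b ^ k.choose 2) := sum_le_sum hterm
    _ = _ := by rw [sum_const, h𝒜, card_powersetCard, card_univ, Fintype.card_fin, nsmul_eq_mul]; ring

/-! ### Markov over `H` -/

/-- **Markov**: the `H` on slice `j'` for which fewer than half of the `k`-sets `A` have `f(H ⊔ K_A) = 1` satisfy
`#badH · C(n,k) ≤ 2 · #{(H, A) : f(H ⊔ K_A) = 0}`. [folklore] -/
theorem card_badH_mul_le (f : (Edge n → Bool) → Bool) (k j' : ℕ) :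
    #((slice n j').filter fun H =>
        2 * #((powersetCard k (univ : Finset (Fin n))).filter fun A => f (H ⊔ cliqueVec A) = true) < n.choose k) *
        n.choose k ≤
      2 * #((slice n j' ×ˢ powersetCard k (univ : Finset (Fin n))).filter fun p => f (p.1 ⊔ cliqueVec p.2) = false) := by
  set 𝒜 := powersetCard k (univ : Finset (Fin n)) with h𝒜
  set badH := (slice n j').filter fun H => 2 * #(𝒜.filter fun A => f (H ⊔ cliqueVec A) = true) < n.choose k
    with hbadH
  have h𝒜card : #𝒜 = n.choose k := by rw [h𝒜, card_powersetCard, card_univ, Fintype.card_fin]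
  -- fibrewise: `#bad ≥ Σ_{H ∈ badH} #{A : f = 0}`
  have hfib : ∑ H ∈ badH, #(𝒜.filter fun A => f (H ⊔ cliqueVec A) = false) ≤
      #((slice n j' ×ˢ 𝒜).filter fun p => f (p.1 ⊔ cliqueVec p.2) = false) := by
    rw [card_filter, sum_product]
    calc ∑ H ∈ badH, #(𝒜.filter fun A => f (H ⊔ cliqueVec A) = false)
        = ∑ H ∈ badH, ∑ A ∈ 𝒜, if f (H ⊔ cliqueVec A) = false then 1 else 0 :=
          sum_congr rfl fun H _ => by rw [card_filter]
      _ ≤ ∑ H ∈ slice n j', ∑ A ∈ 𝒜, if f (H ⊔ cliqueVec A) = false then 1 else 0 :=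
          sum_le_sum_of_subset_of_nonneg (filter_subset _ _) fun _ _ _ => Nat.zero_le _
  -- each bad `H` has more than `C(n,k)/2` rejecting `A`
  have heach : ∀ H ∈ badH, n.choose k ≤ 2 * #(𝒜.filter fun A => f (H ⊔ cliqueVec A) = false) := by
    intro H hH
    rw [hbadH, mem_filter] at hH
    have hsplit := Finset.card_filter_add_card_filter_not (s := 𝒜) (fun A => f (H ⊔ cliqueVec A) = true)
    have : (𝒜.filter fun A => ¬ f (H ⊔ cliqueVec A) = true) = 𝒜.filter fun A => f (H ⊔ cliqueVec A) = false := by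
      refine filter_congr fun A _ => ?_; simp
    rw [this, h𝒜card] at hsplit
    omega
  calc #badH * n.choose k = ∑ H ∈ badH, n.choose k := by rw [sum_const, smul_eq_mul]
    _ ≤ ∑ H ∈ badH, 2 * #(𝒜.filter fun A => f (H ⊔ cliqueVec A) = false) := sum_le_sum heach
    _ = 2 * ∑ H ∈ badH, #(𝒜.filter fun A => f (H ⊔ cliqueVec A) = false) := by rw [mul_sum]
    _ ≤ _ := Nat.mul_le_mul_left 2 hfib

/-- **Registered form** (sub-goal `planted_markov` of stmt-PneNP-14083): the Markov count of bad `H`, all binders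
explicit. [folklore] -/
theorem planted_markov :
    ∀ (n k j' : ℕ) (f : (Edge n → Bool) → Bool),
      #((slice n j').filter fun H =>
        2 * #((powersetCard k (univ : Finset (Fin n))).filter fun A => f (H ⊔ cliqueVec A) = true) < n.choose k) *
        n.choose k ≤
      2 * #((slice n j' ×ˢ powersetCard k (univ : Finset (Fin n))).filter fun p => f (p.1 ⊔ cliqueVec p.2) = false) :=
  fun _ k j' f => card_badH_mul_le f k j'

end Summit.PneNP.PneNP.Theorems.ShallowSliceBound

end
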